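import Literature.IUT.HodgeArakelov.BadPrimeGaussianMonoidsGaloisKummerHomProofs
import Literature.IUT.HodgeArakelov.BadPrimeGaussianMonoidsCohomologyModelProofs3
import Literature.IUT.HodgeArakelov.ThetaEnvDataRecordModel
import Literature.IUT.HodgeArakelov.BadPrimeGaussianMonoidsCor36Proofs

/-!
# [IUTchII] Cor 3.6 (ii) «↷» END-TO-END AT THE GENUINE RECORD `EtaleLevels.thetaEnvRecordKummer`, `Ψ`-LEVEL (EXACT):
# the Galois compatibility of the Frobenioid-theoretic Gaussian monoids, with the labeled copies `(Ψ_{†C_v})_t` read as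
# the constant monoid `𝒪^▷` itself (proof-only; the `∞`-level sequel is `…Cor36GenuineRecordInftyProofs.lean`)

S. Mochizuki, *Inter-universal Teichmüller theory II*, kurims Dec-2020 manuscript, Cor 3.6 (i) p. 99 l. 40–47 (the labeled
copies `(Ψ_{†C_v})_t` with their `G_v(M^Θ_*▶)_t`-actions and Kummer isomorphisms onto `Ψ_cns(M^Θ_*)_t`), Cor 3.6 (ii)
p. 100 l. 23–26 («Thus, each monoid `Ψ_{Fξ}(†F_v)` is equipped with a natural action by `G_v(M^Θ_*▶)_{⟨F_l^⋇⟩}`»), Cor 3.5 (ii)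
p. 95 (bracket l. 3–7 on the writer's render paper:url-5036b4059555: `N`-th roots «uniquely determined, up to multiplication by
an element of the `N`-torsion subgroup»), Rmk 3.6.1 p. 101 [cite: Mochizuki2012, Cor 3.6 (ii) p.100]. Claim key DISPUTED
(D-0012); nothing disputed is asserted here. PROOF-ONLY companion (abc-iut cell, layer L6, seat abc-iut-w5-d192 gen 3; node
**IUTchII:Cor3.6(ii)** «↷», sub-DAG `plan/L6/SUBDAG-IUTchII-Cor-36.md` row Cor-36.ii.r9). NO definition, NO `Prop` fact.

WHAT IS PROVED. At abc-iut-w4-d019's GENUINE Prop 3.1 input record `E := EtaleLevels.thetaEnvRecordKummer … c hA hfi O ι₀`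
(ambient module `lim_J H¹(Π^tp_{Ÿ̲̲} ∩ J, l·Δ_Θ)`, `Ψ_cns := κ(O)` for abc-iut-w4-d007's Kummer map `κ := h1LimKummerOn c hA hfi O`
of a `Π^tp_{X̲̲}`-stable constant monoid `O ≤ A`), with the labeled Frobenioid-theoretic copies `(Ψ_{†C_v})_t` READ AS `O`
ITSELF, acted on by `G_v ≅ Π₀` through the evaluation sections `s_t : Π₀ → Π^tp_{X̲̲}` (Cor 3.6 (i): `G_v(M^Θ_*▶)_t ↷
(Ψ_{†C_v})_t`), and Kummer maps `f_t := R_t ∘ κ : O → lim_{K₀} H¹(Π₀ ∩ K₀, l·Δ_Θ)_{φ₀}` (the genuine `†F_v`-side object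
`Ψ_{†C_v}` of [IUTchI] is J5 of SUBDAG-IUTchII-Prop-31-33-34; the `O`-reading is the `_self` reading of this seat's
`exists_kummerRestrictionTransportIso'_ofKummer_self`, p423855):
* `EtaleLevels.kummer_smul_restriction_eq_thetaEnvRecordKummer` — the labeled Kummer maps are `G_v`-EQUIVARIANT:
  `R_t(κ(s_t(g) · o)) = g · R_t(κ(o))` (abc-iut-w4-d007 `h1LimKummerOn_smul` + abc-iut-w4-d004
  `restriction_conj_section_eq_labelwise`, both THEOREMS at the record);
* **`EtaleLevels.cor36ii_psi_thetaEnvRecordKummer_of_mem_thetaEnv`** — `Ψ`-level «↷», EXACT: if `(R_t κ(x_t))_t ∈ Ψ_ξ(θ) :=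
  ∏ R_t(M^×_TM · θ^ℕ)` then `(R_t κ(s_t(g) · x_t))_t ∈ Ψ_ξ(θ)` — by abc-iut-w4-d004's label-wise Kummer-hom Cor 3.5 (ii)
  `mrange_pi_diagonalStable'_ofKummerHom_labelwise` (p424019) instantiated at the genuine record exactly as in abc-iut-w4-d004's
  `mrange_pi_diagonalStable'_thetaEnvRecordKummer_of_mem_thetaEnv` (…GenuineRecordGaloisProofs, p425081 — whose olean was not
  yet available on the farm when this file was checked, hence the direct call of the generic theorem; no statement of that
  file is restated). The `∞`-level (up to torsion) is the sequel file `…Cor36GenuineRecordInftyProofs.lean`.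
INPUTS (all DATA or model-data properties, every junction hypothesis of Cor 3.5 (ii)/3.6 (ii) being a theorem at the record):
the evaluation sections (`s_t` continuous into `Π^tp_{Ÿ̲̲}`, common coefficient action `φ₀`, sections of an augmentation `q`
whose kernel acts trivially on `O`, restrictions `R_t` pinned), `θ ∈ θ^{i₀}_env(𝕄_*)`, model data (`c`, `O`, `hO`).
HONEST FRAMING: composition of landed theorems over the cell's own objects; no side taken on [IUTchIII] Cor 3.12;
typed ≠ proved ≠ endorsed.
-/

noncomputable section

namespace Literature.IUT.HodgeArakelov

namespace EtaleLevels

open Literature.AnabelianGeometry.EtaleTheta CohomologySystemOfContH1 EtaleThetaDataOfSetting TemperedThetaMonoids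
  BadPrimeGaussianMonoids

variable {p : ℕ} [Fact p.Prime] {D : Literature.AnabelianGeometry.EtaleTheta.ThetaSetting p}
  {E : D.EtaleThetaData} {l : ℕ} (C : E.DoubleUnderline l) (hC : D.Compat) (hS : D.Sec2Hyps)
  (hl : l.Prime) (hp2 : p ≠ 2) (hpl : p ≠ l) (hζ : ∃ ζ : D.K, IsPrimitiveRoot ζ (4 * l))
  (mods : ∀ M : ℕ+, D.CyclotomeMod l M)
  (f : contCocycles D.toTheta D.DeltaTheta C.GtpYdduu) (hf : f ∈ C.rootCocycles hC)
  (hmods : ∀ (M M' : ℕ+) (h : (M : ℕ) ∣ (M' : ℕ)) (x : D.lDeltaTheta l),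
    MuN.red p M M' h ((mods M').red x) = (mods M).red x)
  (h15 : Literature.AnabelianGeometry.EtaleTheta.ThetaSetting.Prop15iii E hC) (L : C.CuspLabels)
  (hZ : ∀ M : ℕ+, Nonempty (ModelCyclotomes.lDeltaQuot (C.rigidData (mods M) hC hS h15 L) ≃*
    Literature.IUT.HodgeTheaters.ZHat))
  (hcharY : EtaleThetaDataOfSetting.PiYddCharacteristic C)
  (hlim : Function.Bijective (rigidLimHom C hC hS hl hp2 hpl hζ mods f hf hmods h15 L hZ))
  [(EtaleThetaDataOfSetting.PiYdd C).Normal]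
  {A : Type} [CommGroup A] [MulDistribMulAction (Pi C) A] [TopologicalSpace A] [RootableBy A ℕ]
  (c : CyclotomeCoefficients (phi C) (D.lDeltaTheta l) A)
  (hA : ∀ b : A, IsOpen (MulAction.stabilizer (Pi C) b : Set (Pi C)))
  (hfi : ∀ b : A, (MulAction.stabilizer (Pi C) b).FiniteIndex)
  (O : Submonoid A) (hO : ∀ (σ : Pi C) (b : A), b ∈ O → σ • b ∈ O) (ι₀ : Pi C)
  {Lbl : Type*} {P₀ : TopGroup.{0}} (φ₀ : P₀ →* D.GtpTheta) (s : Lbl → (P₀ →* Pi C))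
  (hι : ∀ t, Continuous ((MonoidHom.id (Pi C)).comp (s t)))
  (hN : ∀ t, (⊤ : Subgroup P₀).map ((MonoidHom.id (Pi C)).comp (s t)) ≤ PiYdd C)
  (hφ : ∀ t, (phi C).comp ((MonoidHom.id (Pi C)).comp (s t)) = φ₀)

/-- **The labeled Kummer maps `f_t := R_t ∘ κ : O → lim H¹(Π₀ ∩ ·, l·Δ_Θ)_{φ₀}` are `G_v`-EQUIVARIANT** for the action of
`G_v ≅ Π₀` on `O` through the section `s_t` and the labeled conjugation action on the target ([IUTchII] Cor 3.6 (i) p. 99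
l. 40–47: `G_v(M^Θ_*▶)_t ↷ (Ψ_{†C_v})_t ⥲ Ψ_cns(M^Θ_*)_t` «compatible with the respective conjugation actions»): from the
`Π^tp_{X̲̲}`-equivariance of the Kummer map (abc-iut-w4-d007 `h1LimKummerOn_smul`) and the equivariance of the restrictions
along the sections (abc-iut-w4-d004 `restriction_conj_section_eq_labelwise`, Cor 3.5 (ii) `hr`, a theorem at the record).
[cite: Mochizuki2012, Cor 3.6 (i) p.99] -/
theorem kummer_smul_restriction_eq_thetaEnvRecordKummer
    (R : Lbl → ((thetaEnvRecordKummer C hC hS hl hp2 hpl hζ mods f hf hmods h15 L hZ hcharY hlim c hA hfi O ι₀).H →*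
      Multiplicative (h1Lim φ₀ (D.lDeltaTheta l) (⊤ : Subgroup P₀) ⊥)))
    (hR : ∀ t y, Multiplicative.toAdd (R t y) =
      h1LimCongr (D.lDeltaTheta l) ⊤ (hφ t) ⊥
        (h1LimComap (phi C) (D.lDeltaTheta l) ((MonoidHom.id (Pi C)).comp (s t)) (hι t) (hN t)
          (AddEquiv.additiveMultiplicative (h1Lim (phi C) (D.lDeltaTheta l) (PiYdd C) ⊥) (Additive.ofMul y))))
    (t : Lbl) (g : P₀) (o : O) :
    R t (h1LimKummerOn (phi C) (D.lDeltaTheta l) (PiYdd C) c hA hfi O ⟨(s t g) • (o : A), hO (s t g) (o : A) o.2⟩) =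
      h1LimConjMulAut φ₀ (D.lDeltaTheta l) ⊤ g (R t (h1LimKummerOn (phi C) (D.lDeltaTheta l) (PiYdd C) c hA hfi O o)) := by
  have h1 : h1LimKummerOn (phi C) (D.lDeltaTheta l) (PiYdd C) c hA hfi O ⟨(s t g) • (o : A), hO (s t g) (o : A) o.2⟩ =
      (thetaEnvRecordKummer C hC hS hl hp2 hpl hζ mods f hf hmods h15 L hZ hcharY hlim c hA hfi O ι₀).conj (s t g)
        (h1LimKummerOn (phi C) (D.lDeltaTheta l) (PiYdd C) c hA hfi O o) :=
    h1LimKummerOn_smul (phi C) (D.lDeltaTheta l) (PiYdd C) c hA hfi O (s t g) o _ rfl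
  rw [h1]
  exact restriction_conj_section_eq_labelwise
    (thetaEnvRecordKummer C hC hS hl hp2 hpl hζ mods f hf hmods h15 L hZ hcharY hlim c hA hfi O ι₀)
    (phi C) φ₀ (D.lDeltaTheta l) (PiYdd C) (MonoidHom.id (Pi C))
    (AddEquiv.additiveMultiplicative (h1Lim (phi C) (D.lDeltaTheta l) (PiYdd C) ⊥)) s hι hN hφ (fun _ _ => rfl) R hR t g _

/-- **[IUTchII] Cor 3.6 (ii) «↷», `Ψ`-LEVEL, EXACT, AT THE GENUINE RECORD** (p. 100 l. 23–26 «each monoid `Ψ_{Fξ}(†F_v)` is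
equipped with a natural action by `G_v(M^Θ_*▶)_{⟨F_l^⋇⟩}`»), the copies `(Ψ_{†C_v})_t` read as `O`: for every
`θ ∈ θ^{i₀}_env(𝕄_*)` and every tuple `x : Lbl → O` whose labeled Kummer classes `(R_t κ(x_t))_t` lie in the Gaussian monoid
`Ψ_ξ(θ) = ∏ R_t(M^×_TM · θ^ℕ)`, the translated tuple `(s_t(g) · x_t)_t` has the same property — i.e. the Frobenioid-theoretic
copy `(∏ f_t)⁻¹(Ψ_ξ)` is stable under the labelwise `G_v`-action. Inputs = the evaluation-sections data + model data; every
Cor 3.5 (ii) junction is abc-iut-w4-d004's theorem `mrange_pi_diagonalStable'_ofKummerHom_labelwise` at the genuine record (the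
instantiation of `mrange_pi_diagonalStable'_thetaEnvRecordKummer_of_mem_thetaEnv`). [cite: Mochizuki2012, Cor 3.6 (ii) p.100] -/
theorem cor36ii_psi_thetaEnvRecordKummer_of_mem_thetaEnv
    {K : Type*} [Group K] (q : Pi C →* K) (hq : ∀ x : Pi C, q x = 1 → ∀ a ∈ O, x • a = a) (w : P₀ →* K)
    (hsec : ∀ t g, q (s t g) = w g) {i₀ : Pi C}
    {θ : (thetaEnvRecordKummer C hC hS hl hp2 hpl hζ mods f hf hmods h15 L hZ hcharY hlim c hA hfi O ι₀).H}
    (hθ : θ ∈ (thetaEnvRecordKummer C hC hS hl hp2 hpl hζ mods f hf hmods h15 L hZ hcharY hlim c hA hfi O ι₀).thetaEnv i₀)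
    (R : Lbl → ((thetaEnvRecordKummer C hC hS hl hp2 hpl hζ mods f hf hmods h15 L hZ hcharY hlim c hA hfi O ι₀).H →*
      Multiplicative (h1Lim φ₀ (D.lDeltaTheta l) (⊤ : Subgroup P₀) ⊥)))
    (hR : ∀ t y, Multiplicative.toAdd (R t y) =
      h1LimCongr (D.lDeltaTheta l) ⊤ (hφ t) ⊥
        (h1LimComap (phi C) (D.lDeltaTheta l) ((MonoidHom.id (Pi C)).comp (s t)) (hι t) (hN t)
          (AddEquiv.additiveMultiplicative (h1Lim (phi C) (D.lDeltaTheta l) (PiYdd C) ⊥) (Additive.ofMul y))))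
    (t₀ : Lbl) (g : P₀) {x : Lbl → O}
    (hx : (fun t => R t (h1LimKummerOn (phi C) (D.lDeltaTheta l) (PiYdd C) c hA hfi O (x t))) ∈
      MonoidHom.mrange (MonoidHom.pi fun t => (R t).comp (splitMonoid
        (thetaEnvRecordKummer C hC hS hl hp2 hpl hζ mods f hf hmods h15 L hZ hcharY hlim c hA hfi O ι₀).units
        (Submonoid.powers θ)).subtype)) :
    (fun t => R t (h1LimKummerOn (phi C) (D.lDeltaTheta l) (PiYdd C) c hA hfi O
        ⟨(s t g) • ((x t : O) : A), hO (s t g) _ (x t).2⟩)) ∈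
      MonoidHom.mrange (MonoidHom.pi fun t => (R t).comp (splitMonoid
        (thetaEnvRecordKummer C hC hS hl hp2 hpl hζ mods f hf hmods h15 L hZ hcharY hlim c hA hfi O ι₀).units
        (Submonoid.powers θ)).subtype) := by
  have key : (fun t => R t (h1LimKummerOn (phi C) (D.lDeltaTheta l) (PiYdd C) c hA hfi O
      ⟨(s t g) • ((x t : O) : A), hO (s t g) _ (x t).2⟩)) =
      piIso Lbl (h1LimConjMulAut φ₀ (D.lDeltaTheta l) ⊤ g)
        (fun t => R t (h1LimKummerOn (phi C) (D.lDeltaTheta l) (PiYdd C) c hA hfi O (x t))) := by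
    funext t
    exact kummer_smul_restriction_eq_thetaEnvRecordKummer C hC hS hl hp2 hpl hζ mods f hf hmods h15 L hZ hcharY hlim
      c hA hfi O hO ι₀ φ₀ s hι hN hφ R hR t g (x t)
  rw [key]
  -- Cor 3.5 (ii) at the genuine record: `Ψ_ξ` is diagonally stable (abc-iut-w4-d004's label-wise Kummer-hom theorem,
  -- instantiated with the tautological identification `j = id`, `ψ = Additive (Multiplicative lim) ≃ lim`)
  exact mem_of_map_piIso_eq
    (mrange_pi_diagonalStable'_ofKummerHom_labelwise
      (thetaEnvRecordKummer C hC hS hl hp2 hpl hζ mods f hf hmods h15 L hZ hcharY hlim c hA hfi O ι₀)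
      (MulDistribMulAction.toMulAut (Pi C) A) O (fun σ b hb => hO σ b hb)
      (h1LimKummerOn (phi C) (D.lDeltaTheta l) (PiYdd C) c hA hfi O) (phi C) φ₀ (D.lDeltaTheta l) (PiYdd C)
      (MonoidHom.id (Pi C)) (AddEquiv.additiveMultiplicative (h1Lim (phi C) (D.lDeltaTheta l) (PiYdd C) ⊥)) s hι hN hφ
      (ThetaEnvData.toRecord_constantMonoid _ _ _ _)
      (fun (σ : Pi C) m => h1LimKummerOn_smul (phi C) (D.lDeltaTheta l) (PiYdd C) c hA hfi O σ m
        ⟨σ • (m : A), hO σ m m.2⟩ rfl)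
      q (fun x hx' a ha => hq x hx' a ha) w hsec (fun _ _ => rfl) θ
      (toRecord_topClass (thetaEnvData C hC hS hl hp2 hpl hζ mods f hf hmods h15 L hZ hcharY hlim)
        (CohomologySystemOfContH1.h1LimConjMulAut (phi C) (D.lDeltaTheta l) (PiYdd C))
        (h1LimKummerOn (phi C) (D.lDeltaTheta l) (PiYdd C) c hA hfi O)
        (fun g : Pi C => h1LimConjEquiv (phi C) (D.lDeltaTheta l) (PiYdd C) (g * ι₀ * g⁻¹))
        (phi C) (D.lDeltaTheta l) (PiYdd C)
        (AddEquiv.additiveMultiplicative (h1Lim (phi C) (D.lDeltaTheta l) (PiYdd C) ⊥)) (fun y _ => ⟨y, rfl⟩) hθ)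
      R hR t₀ g) hx

end EtaleLevels

end Literature.IUT.HodgeArakelov

end
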